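import Mathlib
import HarnessLib
import Summits.Ventures.LatticeQCDFlow.Exactness.SphereFlowL1Stability
import Summits.Ventures.LatticeQCDFlow.Exactness.SphereLuscherSeriesLocality
import Summits.Ventures.LatticeQCDFlow.TrivializingMaps.FlowLightCone

/-!
# The light cone of the time-dependent trivializing flow on the lattice of site spheres: a site at read-set distance `m + 1` from a modification of the initial configuration moves by at most `2·e^{K|t₁−t₀|}(K|t₁−t₀|)^{m+1}/(m+1)!`, and the flow map is a strictly local map up to that tail — constants independent of the volume

HONEST FRAMING: exact (Metropolis-corrected) sampling algorithms for lattice gauge theory;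
figures of merit are autocorrelation/cost numbers at stated couplings and volumes; no
continuum-physics claim.

Venture `LatticeQCDFlow` (cell pub-lqcd), topic `Exactness`; FANOUT row 7 (`s0-cpn-null`: the
S0-D1 rung — 2D CP⁹, Lüscher's LO trivializing map inside HMC, Engel–Schaefer 2011).  NEW WORK of
the cell over theory-1's THEOREM L (`TrivializingMaps/FlowLightCone.lean` §1,
`LightCone.lightCone_of_hasDerivAt`: the Lieb–Robinson-type light cone for two curves in `W^Λ`
driven by a strictly local sup-Lipschitz generator — pure analysis, reused by import), this leg's
`Exactness/SphereFlowL1Stability.lean` (the flow line reparametrised to `[0, 1]`), GEN-14's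
`Exactness/SphereTimeDependentFlow.lean` (the evolution maps `Φ_{t₀→t}`, conserved site norms) and
GEN-9's `Exactness/SphereLuscherSeriesLocality.lean` (`nball N r n`, the balls of a
neighbourhood structure); nothing is cited as a fact.  Printed counterpart, NAMED ONLY: M. Lüscher, Commun.
Math. Phys. 293 (2010) 899, §3.2 and §4.5 (flow-defined field transformations of a local generator
are local up to exponentially small tails); H. Raz, R. Sims, J. Stat. Phys. 137 (2009) 79, Thm. 1
(the classical-lattice Lieb–Robinson mechanism).  Gauge-side counterpart: the venture statement's
T7/T8 (`StatementLocality.lean`, `TrivializingMaps/TruncatedFlowLightCone.lean`,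
`…/TruncatedFlowReceptiveField.lean`) for Lüscher's truncated Wilson flows on `SU(n)^E`; THIS FILE
is the sphere-side (CP(N−1)/O(N)) instance for every jointly `C²` generator with strict read sets,
discharged for the Engel–Schaefer leading-order generator in the sequel
`Exactness/SphereLOFlowLightCone.lean`.

## Setting

`E` finite-dimensional real inner product space, `Λ` finite, `Ω̃ = {x | ‖x_n‖ = 1}`;
`G : ℝ → (Λ → E) → ℝ` jointly `C²`, horizon `T`, `Φ_{t₀→t₁} = sphereTDFlow hG T t₀ t₁`.  READ SETS
`N i ⊆ Λ` and the SUP-MODULUS of the generator between `t₀` and `t₁`: for `x, y ∈ Ω̃` and `M ≥ 0`,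
`(∀ j ∈ N i, ‖x_j − y_j‖ ≤ M) → ‖∂̃_iG_t(x) − ∂̃_iG_t(y)‖ ≤ K·M` (the velocity at site `i` reads the
configuration on `N i` only, `K`-Lipschitz in the sup norm there).

## Content

* §1 **`norm_sphereTDFlow_sub_le_coneProfile`** — THEOREM L FOR THE SPHERE FLOW: for a level
  function `lvl` with `lvl i ≤ lvl j + 1` (`j ∈ N i`) and initial data `x, y ∈ Ω̃` that are `δ`-close
  and EQUAL at every site of level `≥ 1`,
  `‖Φ_{t₀→t₁}(x)_i − Φ_{t₀→t₁}(y)_i‖ ≤ δ·e^{K|t₁−t₀|}(K|t₁−t₀|)^{lvl i}/(lvl i)!`;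
  `norm_sphereTDFlow_sub_le_exp` (level `0`: `≤ δ·e^{K|t₁−t₀|}` everywhere, the sup-Lipschitz
  constant of the flow map).
* §2 **`norm_sphereTDFlow_sub_le_of_eqOn_nball`** — THE BALL FORM: if `x, y ∈ Ω̃` agree on the
  radius-`m` ball `nball N m i₀` of the read-set structure, then
  `‖Φ_{t₀→t₁}(x)_{i₀} − Φ_{t₀→t₁}(y)_{i₀}‖ ≤ 2·e^{K|t₁−t₀|}(K|t₁−t₀|)^{m+1}/(m+1)!`
  (level `= m + 1 −` read-set distance from `i₀`, truncated); super-exponentially small in the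
  distance, with constants depending on `K|t₁ − t₀|` only — NOT on `|Λ|`.
* §3 **`exists_local_approx_sphereTDFlow`** — THE RECEPTIVE FIELD: for every `m` and every
  reference configuration `e ∈ Ω̃` there is a STRICTLY LOCAL map `Ψ` (its `i`-component depends only
  on the sites in `nball N m i`) with `‖Φ_{t₀→t₁}(x)_i − Ψ(x)_i‖ ≤ 2·e^{K|t₁−t₀|}(K|t₁−t₀|)^{m+1}/(m+1)!`
  for all `x ∈ Ω̃` and all sites `i` — the receptive radius needed for per-site accuracy `ε` is a
  function of `K|t₁ − t₀|` and `ε`, not of the volume.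

NOT CLAIMED: exponential (non-strict) read sets; lower bounds (the cone is not shown to be sharp);
any statement about the generator beyond the hypothesis (the E–S instance is the sequel); numbers
of the rung.
-/

noncomputable section

namespace Summit.Ventures.LatticeQCDFlow.Exactness

open Function Set Metric NormedSpace InnerProductSpace Real
open Summit.Ventures.LatticeQCDFlow.TrivializingMaps
open scoped RealInnerProductSpace Topology Nat

variable {Λ : Type*} {E : Type*} [NormedAddCommGroup E] [InnerProductSpace ℝ E]
  [FiniteDimensional ℝ E] [Fintype Λ] [DecidableEq Λ] {G : ℝ → (Λ → E) → ℝ} {T : ℝ}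

/-! ## §1 THEOREM L for the sphere flow -/

section Cone

/-- **THEOREM L FOR THE TIME-DEPENDENT SPHERE FLOW.**  Read sets `N i`, a sup-modulus `K ≥ 0` of the
generator on `Ω̃` between `t₀` and `t₁`, a level function with `lvl i ≤ lvl j + 1` for `j ∈ N i`,
and two initial configurations `x, y ∈ Ω̃` that are `δ`-close at every site and equal at every site
of level `≥ 1`.  Then for every site `i`:
`‖Φ_{t₀→t₁}(x)_i − Φ_{t₀→t₁}(y)_i‖ ≤ δ·exp(K|t₁−t₀|)·(K|t₁−t₀|)^{lvl i}/(lvl i)!`. -/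
theorem norm_sphereTDFlow_sub_le_coneProfile (hG : ContDiff ℝ 2 fun q : ℝ × (Λ → E) => G q.1 q.2)
    (N : Λ → Set Λ) {K : ℝ} (hK : 0 ≤ K) {t₀ t₁ : ℝ}
    (hmod : ∀ t ∈ uIcc t₀ t₁, ∀ x y : Λ → E, (∀ n, ‖x n‖ = 1) → (∀ n, ‖y n‖ = 1) →
      ∀ (i : Λ) (M : ℝ), 0 ≤ M → (∀ j ∈ N i, ‖x j - y j‖ ≤ M) →
        ‖siteGrad i (G t) x - siteGrad i (G t) y‖ ≤ K * M)
    (lvl : Λ → ℕ) (hlvl : ∀ i, ∀ j ∈ N i, lvl i ≤ lvl j + 1)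
    {x y : Λ → E} (hx : ∀ n, ‖x n‖ = 1) (hy : ∀ n, ‖y n‖ = 1) {δ : ℝ} (hδ : 0 ≤ δ)
    (h0 : ∀ j, ‖x j - y j‖ ≤ δ) (h0' : ∀ i, 1 ≤ lvl i → x i = y i) (i : Λ) :
    ‖sphereTDFlow hG T t₀ t₁ x i - sphereTDFlow hG T t₀ t₁ y i‖ ≤
      δ * Real.exp (K * |t₁ - t₀|) * (K * |t₁ - t₀|) ^ (lvl i) / ((lvl i)! : ℝ) := by
  -- the two reparametrised flow lines
  set X : ℝ → (Λ → E) := fun u => sphereTDFlow hG T t₀ (t₀ + u * (t₁ - t₀)) x with hXdef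
  set Y : ℝ → (Λ → E) := fun u => sphereTDFlow hG T t₀ (t₀ + u * (t₁ - t₀)) y with hYdef
  set X' : ℝ → (Λ → E) := fun u => (t₁ - t₀) • sphereTDField G T (t₀ + u * (t₁ - t₀), X u)
    with hX'def
  set Y' : ℝ → (Λ → E) := fun u => (t₁ - t₀) • sphereTDField G T (t₀ + u * (t₁ - t₀), Y u)
    with hY'def
  have hXd : ∀ u, HasDerivAt X (X' u) u := fun u => hasDerivAt_sphereTDFlow_affine hG t₀ t₁ x u
  have hYd : ∀ u, HasDerivAt Y (Y' u) u := fun u => hasDerivAt_sphereTDFlow_affine hG t₀ t₁ y u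
  have hXn : ∀ u n, ‖X u n‖ = 1 := fun u n => norm_sphereTDFlow_eq_one hG t₀ hx _ n
  have hYn : ∀ u n, ‖Y u n‖ = 1 := fun u n => norm_sphereTDFlow_eq_one hG t₀ hy _ n
  -- the strictly local sup-modulus of the reparametrised velocity, constant `K|t₁ − t₀|`
  have hmod' : ∀ u ∈ Ico (0 : ℝ) 1, ∀ (i : Λ) (M : ℝ), 0 ≤ M →
      (∀ j ∈ N i, ‖X u j - Y u j‖ ≤ M) → ‖X' u i - Y' u i‖ ≤ K * |t₁ - t₀| * M := by
    intro u hu i M hM hN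
    set t : ℝ := t₀ + u * (t₁ - t₀) with htdef
    have ht : t ∈ uIcc t₀ t₁ := mem_uIcc_affine (Ico_subset_Icc_self hu)
    have hψ0 : 0 ≤ (timeBump T : ℝ → ℝ) t := (timeBump T).nonneg
    have hψ1 : (timeBump T : ℝ → ℝ) t ≤ 1 := (timeBump T).le_one
    have hXf : sphereTDField G T (t, X u) = fun n => -((timeBump T : ℝ → ℝ) t • siteGrad n (G t) (X u)) :=
      sphereTDField_eq_of_norm_eq_one t (hXn u)
    have hYf : sphereTDField G T (t, Y u) = fun n => -((timeBump T : ℝ → ℝ) t • siteGrad n (G t) (Y u)) :=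
      sphereTDField_eq_of_norm_eq_one t (hYn u)
    have e : X' u i - Y' u i = (t₁ - t₀) • ((timeBump T : ℝ → ℝ) t •
        -(siteGrad i (G t) (X u) - siteGrad i (G t) (Y u))) := by
      simp only [hX'def, hY'def, Pi.smul_apply, ← htdef, hXf, hYf, smul_neg, smul_sub]
      abel
    rw [e, norm_smul, norm_smul, norm_neg, Real.norm_eq_abs, Real.norm_eq_abs, abs_of_nonneg hψ0]
    have hm := hmod t ht (X u) (Y u) (hXn u) (hYn u) i M hM hN
    calc |t₁ - t₀| * ((timeBump T : ℝ → ℝ) t * ‖siteGrad i (G t) (X u) - siteGrad i (G t) (Y u)‖)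
        ≤ |t₁ - t₀| * (1 * (K * M)) := by gcongr
      _ = K * |t₁ - t₀| * M := by ring
  have h0X : ∀ j, ‖X 0 j - Y 0 j‖ ≤ δ := fun j => by
    simp only [hXdef, hYdef, zero_mul, add_zero, sphereTDFlow_self]; exact h0 j
  have h0X' : ∀ i, 1 ≤ lvl i → X 0 i = Y 0 i := fun i hi => by
    simp only [hXdef, hYdef, zero_mul, add_zero, sphereTDFlow_self]; exact h0' i hi
  have hK' : 0 ≤ K * |t₁ - t₀| := mul_nonneg hK (abs_nonneg _)
  have h := LightCone.lightCone_of_hasDerivAt (T := 1) hK' hδ N lvl hlvl hXd hYd hmod' h0X h0X' 1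
    ⟨zero_le_one, le_rfl⟩ i
  have h1 : t₀ + 1 * (t₁ - t₀) = t₁ := by ring
  simp only [hXdef, hYdef, h1, mul_one] at h
  exact h

/-- **Level `0`: the sup-Lipschitz constant of the flow map.**  Under the sup-modulus, for all
`x, y ∈ Ω̃` with `‖x_j − y_j‖ ≤ δ` everywhere: `‖Φ_{t₀→t₁}(x)_i − Φ_{t₀→t₁}(y)_i‖ ≤ δ·e^{K|t₁−t₀|}` at
every site (`e^{K|t|}`, not `e^{K|Λ||t|}`: the read sets cover each site boundedly often only
through `K`). -/
theorem norm_sphereTDFlow_sub_le_exp (hG : ContDiff ℝ 2 fun q : ℝ × (Λ → E) => G q.1 q.2)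
    (N : Λ → Set Λ) {K : ℝ} (hK : 0 ≤ K) {t₀ t₁ : ℝ}
    (hmod : ∀ t ∈ uIcc t₀ t₁, ∀ x y : Λ → E, (∀ n, ‖x n‖ = 1) → (∀ n, ‖y n‖ = 1) →
      ∀ (i : Λ) (M : ℝ), 0 ≤ M → (∀ j ∈ N i, ‖x j - y j‖ ≤ M) →
        ‖siteGrad i (G t) x - siteGrad i (G t) y‖ ≤ K * M)
    {x y : Λ → E} (hx : ∀ n, ‖x n‖ = 1) (hy : ∀ n, ‖y n‖ = 1) {δ : ℝ} (hδ : 0 ≤ δ)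
    (h0 : ∀ j, ‖x j - y j‖ ≤ δ) (i : Λ) :
    ‖sphereTDFlow hG T t₀ t₁ x i - sphereTDFlow hG T t₀ t₁ y i‖ ≤ δ * Real.exp (K * |t₁ - t₀|) := by
  have h := norm_sphereTDFlow_sub_le_coneProfile hG N hK hmod (fun _ => 0) (fun _ _ _ => by simp)
    hx hy hδ h0 (fun _ h1 => absurd h1 (by simp)) i (T := T)
  simpa using h

end Cone

/-! ## §2 The ball form: agreement on `nball N m i₀` -/

section Ball

/-- **THE LIGHT CONE IN BALL FORM.**  Under the sup-modulus with read sets `N`, if `x, y ∈ Ω̃` agree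
at every site of the radius-`m` ball `nball N m i₀`, then
`‖Φ_{t₀→t₁}(x)_{i₀} − Φ_{t₀→t₁}(y)_{i₀}‖ ≤ 2·exp(K|t₁−t₀|)·(K|t₁−t₀|)^{m+1}/(m+1)!` — constants
depending on `K|t₁ − t₀|` only. -/
theorem norm_sphereTDFlow_sub_le_of_eqOn_nball (hG : ContDiff ℝ 2 fun q : ℝ × (Λ → E) => G q.1 q.2)
    (N : Λ → Set Λ) {K : ℝ} (hK : 0 ≤ K) {t₀ t₁ : ℝ}
    (hmod : ∀ t ∈ uIcc t₀ t₁, ∀ x y : Λ → E, (∀ n, ‖x n‖ = 1) → (∀ n, ‖y n‖ = 1) →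
      ∀ (i : Λ) (M : ℝ), 0 ≤ M → (∀ j ∈ N i, ‖x j - y j‖ ≤ M) →
        ‖siteGrad i (G t) x - siteGrad i (G t) y‖ ≤ K * M)
    {x y : Λ → E} (hx : ∀ n, ‖x n‖ = 1) (hy : ∀ n, ‖y n‖ = 1) (i₀ : Λ) (m : ℕ)
    (hagree : ∀ j ∈ nball N m i₀, x j = y j) :
    ‖sphereTDFlow hG T t₀ t₁ x i₀ - sphereTDFlow hG T t₀ t₁ y i₀‖ ≤
      2 * Real.exp (K * |t₁ - t₀|) * (K * |t₁ - t₀|) ^ (m + 1) / ((m + 1)! : ℝ) := by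
  classical
  -- the truncated read-set distance from `i₀`
  have hex : ∀ j : Λ, ∃ r : ℕ, j ∈ nball N r i₀ ∨ r = m + 1 := fun j => ⟨m + 1, Or.inr rfl⟩
  set r : Λ → ℕ := fun j => Nat.find (hex j) with hrdef
  have hr_le : ∀ j, r j ≤ m + 1 := fun j => Nat.find_min' (hex j) (Or.inr rfl)
  have hr_spec : ∀ j, j ∈ nball N (r j) i₀ ∨ r j = m + 1 := fun j => Nat.find_spec (hex j)
  have hr_mem : ∀ j, r j ≤ m → j ∈ nball N (r j) i₀ := by
    intro j hj
    rcases hr_spec j with h | h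
    · exact h
    · omega
  have hr_min : ∀ j s, j ∈ nball N s i₀ → r j ≤ s := fun j s hs => Nat.find_min' (hex j) (Or.inl hs)
  have hr0 : r i₀ = 0 := le_antisymm (hr_min i₀ 0 (mem_nball_zero.2 rfl)) (Nat.zero_le _)
  -- the level function `m + 1 − r`
  set lvl : Λ → ℕ := fun j => m + 1 - r j with hlvldef
  have hlvl : ∀ i, ∀ j ∈ N i, lvl i ≤ lvl j + 1 := by
    intro i j hj
    simp only [hlvldef]
    rcases Nat.lt_or_ge (r i) (m + 1) with hi | hi
    · have hi' : i ∈ nball N (r i) i₀ := hr_mem i (by omega)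
      have hj' : j ∈ nball N (r i + 1) i₀ := subset_nball_succ_of_mem hi' hj
      have := hr_min j _ hj'
      omega
    · omega
  have h0' : ∀ i, 1 ≤ lvl i → x i = y i := by
    intro i hi
    simp only [hlvldef] at hi
    have hri : r i ≤ m := by omega
    exact hagree i (nball_mono hri i₀ (hr_mem i hri))
  have h0 : ∀ j, ‖x j - y j‖ ≤ 2 := fun j =>
    (norm_sub_le _ _).trans (by rw [hx j, hy j]; norm_num)
  have h := norm_sphereTDFlow_sub_le_coneProfile hG N hK hmod lvl hlvl hx hy zero_le_two h0 h0' i₀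
    (T := T)
  have hl0 : lvl i₀ = m + 1 := by simp only [hlvldef, hr0, Nat.sub_zero]
  rwa [hl0] at h

end Ball

/-! ## §3 The receptive field: the flow map is strictly local up to the cone tail -/

section Receptive

/-- **THE RECEPTIVE FIELD OF THE FLOW MAP.**  Under the sup-modulus with read sets `N`, for every
radius `m` and every reference configuration `e ∈ Ω̃` there is a map `Ψ` on configurations whose
`i`-th component DEPENDS ONLY ON THE SITES OF `nball N m i`, with
`‖Φ_{t₀→t₁}(x)_i − Ψ(x)_i‖ ≤ 2·exp(K|t₁−t₀|)·(K|t₁−t₀|)^{m+1}/(m+1)!` for all `x ∈ Ω̃` and all `i`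
(`Ψ(x)_i = Φ_{t₀→t₁}(x on the ball, e off the ball)_i`). -/
theorem exists_local_approx_sphereTDFlow (hG : ContDiff ℝ 2 fun q : ℝ × (Λ → E) => G q.1 q.2)
    (N : Λ → Set Λ) {K : ℝ} (hK : 0 ≤ K) {t₀ t₁ : ℝ}
    (hmod : ∀ t ∈ uIcc t₀ t₁, ∀ x y : Λ → E, (∀ n, ‖x n‖ = 1) → (∀ n, ‖y n‖ = 1) →
      ∀ (i : Λ) (M : ℝ), 0 ≤ M → (∀ j ∈ N i, ‖x j - y j‖ ≤ M) →
        ‖siteGrad i (G t) x - siteGrad i (G t) y‖ ≤ K * M)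
    (m : ℕ) {e : Λ → E} (he : ∀ n, ‖e n‖ = 1) :
    ∃ Ψ : (Λ → E) → (Λ → E),
      (∀ i, DependsOn (fun x => Ψ x i) (nball N m i)) ∧
      ∀ x : Λ → E, (∀ n, ‖x n‖ = 1) → ∀ i,
        ‖sphereTDFlow hG T t₀ t₁ x i - Ψ x i‖ ≤
          2 * Real.exp (K * |t₁ - t₀|) * (K * |t₁ - t₀|) ^ (m + 1) / ((m + 1)! : ℝ) := by
  classical
  refine ⟨fun x i => sphereTDFlow hG T t₀ t₁ ((nball N m i).piecewise x e) i, fun i => ?_,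
    fun x hx i => ?_⟩
  · -- strict locality: the glued configuration only reads `x` on the ball
    intro x x' hxx'
    simp only
    have hcfg : (nball N m i).piecewise x e = (nball N m i).piecewise x' e := by
      funext j
      by_cases hj : j ∈ nball N m i
      · rw [Set.piecewise_eq_of_mem _ _ _ hj, Set.piecewise_eq_of_mem _ _ _ hj, hxx' j hj]
      · rw [Set.piecewise_eq_of_notMem _ _ _ hj, Set.piecewise_eq_of_notMem _ _ _ hj]
    rw [hcfg]
  · -- the cone tail: `x` and the glued configuration agree on the ball
    have hz : ∀ n, ‖(nball N m i).piecewise x e n‖ = 1 := by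
      intro n
      by_cases hn : n ∈ nball N m i
      · rw [Set.piecewise_eq_of_mem _ _ _ hn]; exact hx n
      · rw [Set.piecewise_eq_of_notMem _ _ _ hn]; exact he n
    exact norm_sphereTDFlow_sub_le_of_eqOn_nball hG N hK hmod hx hz i m
      (fun j hj => (Set.piecewise_eq_of_mem _ _ _ hj).symm) (T := T)

end Receptive

end Summit.Ventures.LatticeQCDFlow.Exactness

end
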